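/-
Origin: expansion seat `planner-pub-hodgecm-mc-axioms-1-g14-0`, handover #W170 2026-08-20T15:53:55Z md5 6df38b3ea16a (PKG bd0ed9b39efb → 6df38b3ea16a; 158 l.; MECHANICAL (iib-R) rewrite v3.1 of the PKG file as it stands (50 token edits; rules R1x1+RX[h₂]x49)) (`HOME/mc/pub-hodgecm-mc-axioms-1-g14/revendor/kit-r55/stage55/HodgeCM/Model/HypCensus/HypOfCensus.lean`, md5 6df38b3ea16a, 158 lines);
landed by the gen-22 packager (p-g22) in gate run 55 REPLACES the earlier landed copy of `HodgeCM/Model/HypCensus/HypOfCensus.lean` (seat copy carried the packager Origin header of an earlier run (stripped)).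
-/
/-
Origin: speedrun cell pub-hodgecm, MODEL-CONSTRUCTION sub-cell, lineage mc-binder-2 (BINDER-OWNERS rows 18/19: E binders
`hyp12` / `hyp34`), seat prover-pub-hodgecm-mc-binder-2-g12-0 (gen 12), 2026-08-20.
Target in PKG: `HodgeCM/Model/HypCensus/HypOfCensus.lean` (NEW additive leaf; imports this lineage's `HypCensus/SideWAssembly` (#55) and
`HypCensus/SideE` (#23, RUN 37)).  KERNEL ONLY: 0 records, nothing cited, 0 `def … : Prop`; the residual junctions are HYPOTHESES.
-/
import Summits.HodgeConjecture.HodgeCM.Model.HypCensus.SideWAssembly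
import Summits.HodgeConjecture.HodgeCM.Model.HypCensus.SideE

/-!
# Rows 18/19 in E's currency: `hyp12` / `hyp34` for the W family of the census, modulo the named residuals

#23 (`SideE`) proves E's binders `hyp12`/`hyp34` VERBATIM from one `HypCoreW (W V c) c.D.jT₁₂ …` / `… jT₃₄ …` per good sextic context,
for ANY `W`; #55 (`SideWAssembly`) assembles those records at the W pin of record.  This leaf composes the two for the W FAMILY OF THE CENSUS
`Wcm hGR η hη hηc := fun V c => wmInputCM₂g V c.D (hGR V c) (η V c) (hη V c) (hηc V c) ι₁ V.sylvesterFrame _` (Sylvester ball frame at `ι₁`):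

* **`hyp12_of_census`**: E's `hyp12` (its quantified type, verbatim, at `W := Wcm …`) from the per-context residual families
  `hκ` ((V-val)), `homg` ((J-T12), `∀ φ` form), `hdense` ((J-dense)) at the exponents `(-μ c 0, -μ c 1)`; the regime `IsAnisotropic L V.Hm`
  (`isAnisotropic_of_goodCtx`) and the sign fact `hW` (`WGuard.dW_definite_of_thetaModel_goodCtx`) are DERIVED from the good sextic context;
* **`hyp34_of_census`**: the same for `hyp34` (`jT₃₄`, exponents `(-μ c 2, -μ c 3)`, `homg₃₄` for `ins₃₄`; `hdense` for the (12)-type insertion at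
  the (34) exponents, transported by #54).

Nothing here is a claim of PerL/QW8.
-/

set_option autoImplicit false

noncomputable section

open scoped TensorProduct InnerProductSpace Matrix Topology Classical
open Filter
open NumberField NumberField.InfinitePlace

namespace HodgeCM.Model.HypCensus

open HodgeCM HodgeCM.Model HodgeCM.Universe HodgeCM.Adelic
open HodgeCM.Universe (AdelicThetaCore AdelicThetaCore₀ SideData ThetaModel)
open HodgeCM.PerL34 HodgeCM.PerL34.ArchC HodgeCM.PerL34.Fock HodgeCM.PerL34.Fock.PrintDict
open Literature.AlgebraicGeometry.HodgeTheory
open Literature.NumberTheory.Automorphic.PicardCM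
open Literature.NumberTheory.Transcendental (Arapura2012_Cor_15_4_6)
open Literature.NumberTheory.Automorphic (piSchwartzBruhat FinSB)
open Literature.NumberTheory.Automorphic.UnitaryGroup
open Literature.NumberTheory.Weil1964 (repWeilThetaDatum)
open Literature.NumberTheory.GelbartRogawski1991 Literature.NumberTheory.GelbartRogawski1991.UnitaryDualPair
open NumberField.SeesawArchTorus

section E

variable (hHD : exists_isReal_hodgeModel) (hI : hodgePQ_independent_of_hodgeModel)
  (h₁ : BallQuotientUniformised)  (h₃ : CMAbelianVarietyRealised)
variable (h : Bool) (hA : Arapura2012_Cor_15_4_6)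
variable
  (hGR : ∀ {L : CMField} {ι₁ : L →+* ℂ} (V : HermSpace3 L ι₁) (c : SeesawCtx L),
    (cmSplittingDatum (L : Type) finProdFinEquiv (frameD V) (frameD_real V) (frameD_ne V) (dW c.D) (dW_real c.D) (dW_ne c.D)).CompatibleSplitting)
  (η : ∀ {L : CMField} {ι₁ : L →+* ℂ} (V : HermSpace3 L ι₁) (c : SeesawCtx L),
    CMAdelic (L : Type) (frameD V) × CMAdelic (L : Type) (dW c.D) →* ℂˣ)
  (hη : ∀ {L : CMField} {ι₁ : L →+* ℂ} (V : HermSpace3 L ι₁) (c : SeesawCtx L),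
    ∀ γU ∈ CMRat (L : Type) (frameD V), ∀ γ ∈ CMRat (L : Type) (dW c.D), η V c (γU, γ) = 1)
  (hηc : ∀ {L : CMField} {ι₁ : L →+* ℂ} (V : HermSpace3 L ι₁) (c : SeesawCtx L), Continuous fun p => ((η V c p : ℂˣ) : ℂ))
  (S : ∀ {L : CMField} {ι₁ : L →+* ℂ} (V : HermSpace3 L ι₁) (c : SeesawCtx L), ThetaAdelicSide V c)
  (μ : ∀ {L : CMField}, SeesawCtx L → Fin 4 → InfinitePlace L → ℤ)

/-- **the W family of the census**: the `wm` input of record at the Sylvester ball frame of `ι₁`, per `(V, c)`. -/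
abbrev Wcm : ∀ {L : CMField} {ι₁ : L →+* ℂ} (V : HermSpace3 L ι₁) (c : SeesawCtx L), WmInput V c.D :=
  fun {_} {ι₁} V c => wmInputCM₂g V c.D (hGR V c) (η V c) (hη V c) (hηc V c) ι₁ V.sylvesterFrame (sylvesterFrame_formCongr V)

/-- **E's binder `hyp12` (row 18) FOR THE W FAMILY OF THE CENSUS, modulo the named residual families** `hκ`, `homg`, `hdense`
(the regime `IsAnisotropic L V.Hm` and the sign fact are DERIVED from the good sextic context). -/
theorem hyp12_of_census
    (jD : ∀ {L : CMField} {ι₁ : L →+* ℂ} (_V : HermSpace3 L ι₁) (_c : SeesawCtx L), InfinitePlace (L : Type) → EqVar → Fin 6)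
    (hκ : ∀ {L : CMField} {ι₁ : L →+* ℂ} (V : HermSpace3 L ι₁) (c : SeesawCtx L)
      (hW : (∀ j, 0 < (ι₁ ((dW c.D) j)).re) ∨ ∀ j, (ι₁ ((dW c.D) j)).re < 0), ∀ k : ↥(KInfty V),
      ((η V c (kPair V c.D ι₁ V.sylvesterFrame (sylvesterFrame_formCongr V) k) : ℂˣ) : ℂ) *
          ((pinLetterChar V c.D (hGR V c) hW (kVLetters V c.D (lett V c.D k)) : Circle) : ℂ) * dVIota V c.D (lett V c.D k (cmPlace (L : Type) ι₁)) =
        ((Literature.NumberTheory.Automorphic.UnitaryGroup.archKappa (L : Type) V.Hm ι₁ V.sylvesterFrame (sylvesterFrame_formCongr V) k : ℂˣ) : ℂ))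
    (homg : ∀ {L : CMField} {ι₁ : L →+* ℂ} (V : HermSpace3 L ι₁) (c : SeesawCtx L)
      (hW : (∀ j, 0 < (ι₁ ((dW c.D) j)).re) ∨ ∀ j, (ι₁ ((dW c.D) j)).re < 0) (f : FinSB ↥(maximalRealSubfield L) (Fin 6))
      (t : (printedAt V c.D hW (jD V c) (fun w => -μ c 0 w) (fun w => -μ c 1 w)).Tg)
      (φ : (printedAt V c.D hW (jD V c) (fun w => -μ c 0 w) (fun w => -μ c 1 w)).F),
      omgW (Wcm hGR η hη hηc V c)
          (printedTorusHom (kindOf (L : Type) (frameD V) (frameD_real V) (dW c.D) (dW_real c.D) ι₁ (datumAt V c.D (jD V c) (jIOf V c.D hW)))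
            (lamOf (L : Type) (frameD V) (frameD_real V) (dW c.D) (dW_real c.D) ι₁ (datumAt V c.D (jD V c) (jIOf V c.D hW)))
            (lamOf_ne_zero (L : Type) (frameD V) (frameD_real V) (dW c.D) (dW_real c.D) ι₁ (datumAt V c.D (jD V c) (jIOf V c.D hW)))
            (c.D.jT₁₂.toMonoidHom.comp (toAdeles (L : Type)))
            (pinnedVacs (kindOf (L : Type) (frameD V) (frameD_real V) (dW c.D) (dW_real c.D) ι₁ (datumAt V c.D (jD V c) (jIOf V c.D hW)))
              (fun w => -μ c 0 w) (fun w => -μ c 1 w)) t)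
          (ins (L : Type) (frameD V) (frameD_real V) (frameD_ne V) (dW c.D) (dW_real c.D) (dW_ne c.D) ι₁ (datumAt V c.D (jD V c) (jIOf V c.D hW))
            (fun w => -μ c 0 w) (fun w => -μ c 1 w) f φ) =
        ins (L : Type) (frameD V) (frameD_real V) (frameD_ne V) (dW c.D) (dW_real c.D) (dW_ne c.D) ι₁ (datumAt V c.D (jD V c) (jIOf V c.D hW))
          (fun w => -μ c 0 w) (fun w => -μ c 1 w) f ((printedAt V c.D hW (jD V c) (fun w => -μ c 0 w) (fun w => -μ c 1 w)).ωT t φ))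
    (hdense : ∀ {L : CMField} {ι₁ : L →+* ℂ} (V : HermSpace3 L ι₁) (c : SeesawCtx L)
      (hW : (∀ j, 0 < (ι₁ ((dW c.D) j)).re) ∨ ∀ j, (ι₁ ((dW c.D) j)).re < 0),
      ∀ Φ ∈ (Wcm hGR η hη hηc V c).SK, toTop (Wcm hGR η hη hηc V c) Φ ∈ closure (toTop (Wcm hGR η hη hηc V c) ''
        (Submodule.span ℂ (Set.range fun q : FinSB ↥(maximalRealSubfield L) (Fin 6) ×
          (printedAt V c.D hW (jD V c) (fun w => -μ c 0 w) (fun w => -μ c 1 w)).F =>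
          ins (L : Type) (frameD V) (frameD_real V) (frameD_ne V) (dW c.D) (dW_real c.D) (dW_ne c.D) ι₁ (datumAt V c.D (jD V c) (jIOf V c.D hW))
            (fun w => -μ c 0 w) (fun w => -μ c 1 w) q.1 q.2) : Set (CMSchwartz (L : Type) 6)))) :
    ∀ {L : CMField} {ι₁ : L →+* ℂ} (V : HermSpace3 L ι₁) (c : SeesawCtx L),
      (thetaModelOf hHD hI h₁ h₃ h (_root_.HodgeCM.Model.embOf hHD hI h₁ h₃) (coverOf hHD hI h₁ h₃ hA) (wmOfInput (Wcm hGR η hη hηc)) (thetaOf _ (thetaClassInputOf _ (fun V c => thetaSpaceInputOf hHD hI h₁ h₃ S V c))) (d12Of μ) (d34Of μ)).GoodCtx ι₁ c → Module.finrank ℚ c.K = 6 →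
      Nonempty (((coreOf _ (_root_.HodgeCM.Model.embOf hHD hI h₁ h₃) (coverOf hHD hI h₁ h₃ hA) (wmOfInput (Wcm hGR η hη hηc)) (thetaOf _ (thetaClassInputOf _ (fun V c => thetaSpaceInputOf hHD hI h₁ h₃ S V c)))).toCore h).HypSmoothCore12
        (((coreOf _ (_root_.HodgeCM.Model.embOf hHD hI h₁ h₃) (coverOf hHD hI h₁ h₃ hA) (wmOfInput (Wcm hGR η hη hηc)) (thetaOf _ (thetaClassInputOf _ (fun V c => thetaSpaceInputOf hHD hI h₁ h₃ S V c)))).toCore h).side12 (d12Of μ)) (((coreOf _ (_root_.HodgeCM.Model.embOf hHD hI h₁ h₃) (coverOf hHD hI h₁ h₃ hA) (wmOfInput (Wcm hGR η hη hηc)) (thetaOf _ (thetaClassInputOf _ (fun V c => thetaSpaceInputOf hHD hI h₁ h₃ S V c)))).toCore h).side34 (d34Of μ))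
        ((((coreOf _ (_root_.HodgeCM.Model.embOf hHD hI h₁ h₃) (coverOf hHD hI h₁ h₃ hA) (wmOfInput (Wcm hGR η hη hηc)) (thetaOf _ (thetaClassInputOf _ (fun V c => thetaSpaceInputOf hHD hI h₁ h₃ S V c)))).toCore h).analyticKM (((coreOf _ (_root_.HodgeCM.Model.embOf hHD hI h₁ h₃) (coverOf hHD hI h₁ h₃ hA) (wmOfInput (Wcm hGR η hη hηc)) (thetaOf _ (thetaClassInputOf _ (fun V c => thetaSpaceInputOf hHD hI h₁ h₃ S V c)))).toCore h).side12 (d12Of μ))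
          (((coreOf _ (_root_.HodgeCM.Model.embOf hHD hI h₁ h₃) (coverOf hHD hI h₁ h₃ hA) (wmOfInput (Wcm hGR η hη hηc)) (thetaOf _ (thetaClassInputOf _ (fun V c => thetaSpaceInputOf hHD hI h₁ h₃ S V c)))).toCore h).side34 (d34Of μ))).toAnalytic) V c (ℓ := linOfInput (Wcm hGR η hη hηc) V c)) :=
  hyp12_of_sideW hHD hI h₁ h₃ h hA (Wcm hGR η hη hηc) S μ fun V c hc hK =>
    nonempty_hypCoreW₁₂_wmInputCM₂g V c.D (hGR V c) (η V c) (hη V c) (hηc V c) (isAnisotropic_of_goodCtx V hc hK)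
      (WGuard.dW_definite_of_thetaModel_goodCtx _ c (cpinC hHD hI h₁ h₃ hA (Wcm hGR η hη hηc) S) h (d12Of μ) (d34Of μ) hc)
      (jD V c) (fun w => -μ c 0 w) (fun w => -μ c 1 w) (hκ V c _) (homg V c _) (hdense V c _)

/-- **E's binder `hyp34` (row 19) FOR THE W FAMILY OF THE CENSUS, modulo the named residual families** `hκ`, `homg₃₄`, `hdense`. -/
theorem hyp34_of_census
    (jD : ∀ {L : CMField} {ι₁ : L →+* ℂ} (_V : HermSpace3 L ι₁) (_c : SeesawCtx L), InfinitePlace (L : Type) → EqVar → Fin 6)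
    (hκ : ∀ {L : CMField} {ι₁ : L →+* ℂ} (V : HermSpace3 L ι₁) (c : SeesawCtx L)
      (hW : (∀ j, 0 < (ι₁ ((dW c.D) j)).re) ∨ ∀ j, (ι₁ ((dW c.D) j)).re < 0), ∀ k : ↥(KInfty V),
      ((η V c (kPair V c.D ι₁ V.sylvesterFrame (sylvesterFrame_formCongr V) k) : ℂˣ) : ℂ) *
          ((pinLetterChar V c.D (hGR V c) hW (kVLetters V c.D (lett V c.D k)) : Circle) : ℂ) * dVIota V c.D (lett V c.D k (cmPlace (L : Type) ι₁)) =
        ((Literature.NumberTheory.Automorphic.UnitaryGroup.archKappa (L : Type) V.Hm ι₁ V.sylvesterFrame (sylvesterFrame_formCongr V) k : ℂˣ) : ℂ))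
    (homg₃₄ : ∀ {L : CMField} {ι₁ : L →+* ℂ} (V : HermSpace3 L ι₁) (c : SeesawCtx L)
      (hW : (∀ j, 0 < (ι₁ ((dW c.D) j)).re) ∨ ∀ j, (ι₁ ((dW c.D) j)).re < 0) (f : FinSB ↥(maximalRealSubfield L) (Fin 6))
      (t : (printedAt V c.D hW (jD V c) (fun w => -μ c 2 w) (fun w => -μ c 3 w)).Tg)
      (φ : (printedAt V c.D hW (jD V c) (fun w => -μ c 2 w) (fun w => -μ c 3 w)).F),
      omgW (Wcm hGR η hη hηc V c)
          (printedTorusHom (kindOf (L : Type) (frameD V) (frameD_real V) (dW c.D) (dW_real c.D) ι₁ (datumAt V c.D (jD V c) (jIOf V c.D hW)))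
            (lamOf (L : Type) (frameD V) (frameD_real V) (dW c.D) (dW_real c.D) ι₁ (datumAt V c.D (jD V c) (jIOf V c.D hW)))
            (lamOf_ne_zero (L : Type) (frameD V) (frameD_real V) (dW c.D) (dW_real c.D) ι₁ (datumAt V c.D (jD V c) (jIOf V c.D hW)))
            (c.D.jT₃₄.toMonoidHom.comp (toAdeles (L : Type)))
            (pinnedVacs (kindOf (L : Type) (frameD V) (frameD_real V) (dW c.D) (dW_real c.D) ι₁ (datumAt V c.D (jD V c) (jIOf V c.D hW)))
              (fun w => -μ c 2 w) (fun w => -μ c 3 w)) t)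
          (ins₃₄ V c.D (hGR V c) (η V c) (datumAt V c.D (jD V c) (jIOf V c.D hW)) (fun w => -μ c 2 w) (fun w => -μ c 3 w) f φ) =
        ins₃₄ V c.D (hGR V c) (η V c) (datumAt V c.D (jD V c) (jIOf V c.D hW)) (fun w => -μ c 2 w) (fun w => -μ c 3 w) f
          ((printedAt V c.D hW (jD V c) (fun w => -μ c 2 w) (fun w => -μ c 3 w)).ωT t φ))
    (hdense : ∀ {L : CMField} {ι₁ : L →+* ℂ} (V : HermSpace3 L ι₁) (c : SeesawCtx L)
      (hW : (∀ j, 0 < (ι₁ ((dW c.D) j)).re) ∨ ∀ j, (ι₁ ((dW c.D) j)).re < 0),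
      ∀ Φ ∈ (Wcm hGR η hη hηc V c).SK, toTop (Wcm hGR η hη hηc V c) Φ ∈ closure (toTop (Wcm hGR η hη hηc V c) ''
        (Submodule.span ℂ (Set.range fun q : FinSB ↥(maximalRealSubfield L) (Fin 6) ×
          (printedAt V c.D hW (jD V c) (fun w => -μ c 2 w) (fun w => -μ c 3 w)).F =>
          ins (L : Type) (frameD V) (frameD_real V) (frameD_ne V) (dW c.D) (dW_real c.D) (dW_ne c.D) ι₁ (datumAt V c.D (jD V c) (jIOf V c.D hW))
            (fun w => -μ c 2 w) (fun w => -μ c 3 w) q.1 q.2) : Set (CMSchwartz (L : Type) 6)))) :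
    ∀ {L : CMField} {ι₁ : L →+* ℂ} (V : HermSpace3 L ι₁) (c : SeesawCtx L),
      (thetaModelOf hHD hI h₁ h₃ h (_root_.HodgeCM.Model.embOf hHD hI h₁ h₃) (coverOf hHD hI h₁ h₃ hA) (wmOfInput (Wcm hGR η hη hηc)) (thetaOf _ (thetaClassInputOf _ (fun V c => thetaSpaceInputOf hHD hI h₁ h₃ S V c))) (d12Of μ) (d34Of μ)).GoodCtx ι₁ c → Module.finrank ℚ c.K = 6 →
      Nonempty (((coreOf _ (_root_.HodgeCM.Model.embOf hHD hI h₁ h₃) (coverOf hHD hI h₁ h₃ hA) (wmOfInput (Wcm hGR η hη hηc)) (thetaOf _ (thetaClassInputOf _ (fun V c => thetaSpaceInputOf hHD hI h₁ h₃ S V c)))).toCore h).HypSmoothCore34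
        (((coreOf _ (_root_.HodgeCM.Model.embOf hHD hI h₁ h₃) (coverOf hHD hI h₁ h₃ hA) (wmOfInput (Wcm hGR η hη hηc)) (thetaOf _ (thetaClassInputOf _ (fun V c => thetaSpaceInputOf hHD hI h₁ h₃ S V c)))).toCore h).side12 (d12Of μ)) (((coreOf _ (_root_.HodgeCM.Model.embOf hHD hI h₁ h₃) (coverOf hHD hI h₁ h₃ hA) (wmOfInput (Wcm hGR η hη hηc)) (thetaOf _ (thetaClassInputOf _ (fun V c => thetaSpaceInputOf hHD hI h₁ h₃ S V c)))).toCore h).side34 (d34Of μ))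
        ((((coreOf _ (_root_.HodgeCM.Model.embOf hHD hI h₁ h₃) (coverOf hHD hI h₁ h₃ hA) (wmOfInput (Wcm hGR η hη hηc)) (thetaOf _ (thetaClassInputOf _ (fun V c => thetaSpaceInputOf hHD hI h₁ h₃ S V c)))).toCore h).analyticKM (((coreOf _ (_root_.HodgeCM.Model.embOf hHD hI h₁ h₃) (coverOf hHD hI h₁ h₃ hA) (wmOfInput (Wcm hGR η hη hηc)) (thetaOf _ (thetaClassInputOf _ (fun V c => thetaSpaceInputOf hHD hI h₁ h₃ S V c)))).toCore h).side12 (d12Of μ))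
          (((coreOf _ (_root_.HodgeCM.Model.embOf hHD hI h₁ h₃) (coverOf hHD hI h₁ h₃ hA) (wmOfInput (Wcm hGR η hη hηc)) (thetaOf _ (thetaClassInputOf _ (fun V c => thetaSpaceInputOf hHD hI h₁ h₃ S V c)))).toCore h).side34 (d34Of μ))).toAnalytic) V c (ℓ := linOfInput (Wcm hGR η hη hηc) V c)) :=
  hyp34_of_sideW hHD hI h₁ h₃ h hA (Wcm hGR η hη hηc) S μ fun V c hc hK =>
    nonempty_hypCoreW₃₄_wmInputCM₂g V c.D (hGR V c) (η V c) (hη V c) (hηc V c) (isAnisotropic_of_goodCtx V hc hK)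
      (WGuard.dW_definite_of_thetaModel_goodCtx _ c (cpinC hHD hI h₁ h₃ hA (Wcm hGR η hη hηc) S) h (d12Of μ) (d34Of μ) hc)
      (jD V c) (fun w => -μ c 2 w) (fun w => -μ c 3 w) (hκ V c _) (homg₃₄ V c _) (hdense V c _)

end E

end HodgeCM.Model.HypCensus

end
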